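import Summits.CriticalPhenomena.SAWScalingLimit.Theorems.SAWCircleScreeningScreeningRecursionWalks
import Literature.Probability.RandomPlanarGeometry.SelfAvoidingWalkProofs
import HarnessLib

/-!
# Screening recursion for `SAWCircleScreening`, part XIII: the critical SAW law as a probability vector

Route `SAWCircleScreening` of `CriticalPhenomena/SAWScalingLimit`, support item
`ScreeningRecursion` (stmt-CriticalPhenomena-5468). The abstract coupling step (part IIb) is
phrased for finite probability vectors `p : X → ℝ`; this file presents the critical SAW law of a
bounded discrete domain in that form:

* `law_univ_eq_one_of_reachable` — if `a`, `b` are joined in `Ω_δ` (bounded `Ω`, `δ > 0`) the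
  law is a probability measure (a SAW exists: `SimpleGraph.Walk.toPath`; `x_c > 0`);
* `toReal_law_eq_sum` — `(law S).toReal = ∑ γ, p γ · 1_S(γ)` with `p γ = (law {γ}).toReal` on the
  finite type of SAWs; `sum_toReal_law_singleton` — `∑ γ, p γ = (law univ).toReal`;
* `toReal_law_inter_eq_sum_filter` — fibre form `(law ({f = v} ∩ S)).toReal = ∑_{f γ = v} p γ 1_S`.

Folklore. Mathlib anchors: `measure_biUnion_finset`, `ENNReal.toReal_sum`.
-/

noncomputable section

open Set Metric MeasureTheory Finset
open scoped ENNReal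
open Literature.Probability.LatticeModels
open Literature.Probability.RandomPlanarGeometry
open Literature.Probability.RandomPlanarGeometry.SAW

namespace Summit.CriticalPhenomena.SAWScalingLimit.Theorems.ScreeningRecursion

variable {Ω : Set ℂ} {δ : ℝ} {a b : Site 2}

/-! ## Probability normalisation -/

/-- Joined endpoints give a SAW (the path of a joining walk), hence positive total weight.
[folklore] -/
theorem weight_univ_ne_zero_of_reachable (h : (discreteDomainGraph Ω δ).Reachable a b) :
    weight Ω δ a b univ ≠ 0 := by
  classical
  obtain ⟨p⟩ := h
  set γ : DomainSAW Ω δ a b := ⟨p.toPath.1, p.toPath.2⟩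
  intro h0
  have h1 := weight_singleton_le_of_mem (mem_univ γ)
  rw [h0, nonpos_iff_eq_zero, ENNReal.ofReal_eq_zero] at h1
  exact absurd h1 (not_le.2 (pow_pos criticalFugacity_pos_lt_one'.1 _))

/-- **The critical SAW law of a bounded domain between joined endpoints is a probability
measure.** [folklore] -/
theorem law_univ_eq_one_of_reachable (hΩ : Bornology.IsBounded Ω) (hδ : 0 < δ)
    (h : (discreteDomainGraph Ω δ).Reachable a b) : law Ω δ a b univ = 1 :=
  law_univ_eq_one (weight_univ_ne_zero_of_reachable h) (weight_univ_ne_top hΩ hδ a b)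

/-- Probability-measure instance form. [folklore] -/
theorem isProbabilityMeasure_law_of_reachable (hΩ : Bornology.IsBounded Ω) (hδ : 0 < δ)
    (h : (discreteDomainGraph Ω δ).Reachable a b) : IsProbabilityMeasure (law Ω δ a b) :=
  ⟨law_univ_eq_one_of_reachable hΩ hδ h⟩

/-! ## The law as a finite sum of point masses -/

/-- On the (finite, discrete) type of SAWs, the measure of a set is the sum of its point masses.
[folklore] -/
theorem law_eq_sum_singleton [Fintype (DomainSAW Ω δ a b)] (S : Set (DomainSAW Ω δ a b))
    [DecidablePred (· ∈ S)] :
    law Ω δ a b S = ∑ γ, (if γ ∈ S then law Ω δ a b {γ} else 0) := by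
  classical
  have hS : S = ⋃ γ ∈ (Finset.univ.filter (· ∈ S) : Finset (DomainSAW Ω δ a b)), ({γ} : Set _) := by
    ext x; simp
  conv_lhs => rw [hS]
  rw [measure_biUnion_finset]
  · rw [Finset.sum_filter]
  · intro x _ y _ hxy
    exact disjoint_singleton.2 hxy
  · exact fun _ _ => MeasurableSpace.measurableSet_top

/-- **The law as a probability vector**: `(law S).toReal = ∑ γ, p γ · 1_S(γ)` with
`p γ = (law {γ}).toReal`. [folklore] -/
theorem toReal_law_eq_sum [Fintype (DomainSAW Ω δ a b)] (S : Set (DomainSAW Ω δ a b))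
    [DecidablePred (· ∈ S)] :
    (law Ω δ a b S).toReal = ∑ γ, (law Ω δ a b {γ}).toReal * (if γ ∈ S then 1 else 0) := by
  rw [law_eq_sum_singleton S, ENNReal.toReal_sum (fun γ _ => ?_)]
  · refine Finset.sum_congr rfl fun γ _ => ?_
    split_ifs <;> simp
  · split_ifs
    · exact law_apply_ne_top _
    · exact ENNReal.zero_ne_top

/-- The point masses sum to the total mass. [folklore] -/
theorem sum_toReal_law_singleton [Fintype (DomainSAW Ω δ a b)] :
    ∑ γ, (law Ω δ a b {γ}).toReal = (law Ω δ a b univ).toReal := by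
  classical
  rw [toReal_law_eq_sum univ]
  simp

/-- Point masses are nonnegative. [folklore] -/
theorem toReal_law_singleton_nonneg (γ : DomainSAW Ω δ a b) : 0 ≤ (law Ω δ a b {γ}).toReal :=
  ENNReal.toReal_nonneg

/-- Every SAW has positive mass under a normalised law (`x_c > 0`). [folklore] -/
theorem toReal_law_singleton_pos (hΩ : Bornology.IsBounded Ω) (hδ : 0 < δ) (γ : DomainSAW Ω δ a b) :
    0 < (law Ω δ a b {γ}).toReal := by
  have hZ0 : weight Ω δ a b univ ≠ 0 := fun h0 => by
    have h1 := weight_singleton_le_of_mem (mem_univ γ)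
    rw [h0, nonpos_iff_eq_zero, ENNReal.ofReal_eq_zero] at h1
    exact absurd h1 (not_le.2 (pow_pos criticalFugacity_pos_lt_one'.1 _))
  have hZt : weight Ω δ a b univ ≠ ⊤ := weight_univ_ne_top hΩ hδ a b
  rw [law_apply_eq_inv_mul_weight, weight_singleton]
  refine ENNReal.toReal_pos (mul_ne_zero (ENNReal.inv_ne_zero.2 hZt) ?_)
    (ENNReal.mul_ne_top (ENNReal.inv_ne_top.2 hZ0) ENNReal.ofReal_ne_top)
  rw [ne_eq, ENNReal.ofReal_eq_zero, not_le]
  exact pow_pos criticalFugacity_pos_lt_one'.1 _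

/-- **Fibre form.** For a map `f` on SAWs and a set `S`:
`(law ({γ | f γ = v} ∩ S)).toReal = ∑_{γ : f γ = v} p γ · 1_S(γ)`. [folklore] -/
theorem toReal_law_inter_eq_sum_filter [Fintype (DomainSAW Ω δ a b)] {Y : Type*} [DecidableEq Y]
    (f : DomainSAW Ω δ a b → Y) (v : Y) (S : Set (DomainSAW Ω δ a b)) [DecidablePred (· ∈ S)] :
    (law Ω δ a b ({γ | f γ = v} ∩ S)).toReal =
      ∑ γ ∈ Finset.univ.filter (fun γ => f γ = v), (law Ω δ a b {γ}).toReal * (if γ ∈ S then 1 else 0) := by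
  classical
  rw [toReal_law_eq_sum ({γ | f γ = v} ∩ S), Finset.sum_filter]
  refine Finset.sum_congr rfl fun γ _ => ?_
  by_cases h1 : f γ = v <;> by_cases h2 : γ ∈ S <;> simp [h1, h2]

/-! ## Regrouping a weighted sum along a map -/

/-- `∑ₓ w x · G (h x) = ∑_{y ∈ image h} G y · ∑_{h x = y} w x`. [folklore] -/
theorem sum_mul_apply_eq_sum_image {X Y : Type*} [Fintype X] [DecidableEq Y] (w : X → ℝ)
    (h : X → Y) (G : Y → ℝ) :
    ∑ x, w x * G (h x) = ∑ y ∈ univ.image h, G y * ∑ x ∈ univ.filter (fun x => h x = y), w x := by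
  rw [← Finset.sum_fiberwise_of_maps_to (s := univ) (t := univ.image h) (g := h)
    (fun x _ => mem_image_of_mem h (mem_univ x))]
  refine Finset.sum_congr rfl fun y _ => ?_
  rw [Finset.mul_sum]
  refine Finset.sum_congr rfl fun x hx => ?_
  rw [(Finset.mem_filter.1 hx).2]
  ring

end Summit.CriticalPhenomena.SAWScalingLimit.Theorems.ScreeningRecursion

end
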